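import Summits.Parity.GeneralizedHardyLittlewood.Theorems.BeyondDiagonalBeatsQuarter.KernelFormXSq
import Literature.NumberTheory.Sieve.BombieriAsymptoticSieveLemma3
import Literature.NumberTheory.LFunctions.RosserSchoenfeldVonMangoldtSum
import Literature.NumberTheory.LFunctions.VonMangoldtSqHarmonicMoments
import Literature.NumberTheory.Sieve.PowerfulPartDecomposition
import HarnessLib

/-!
# Route `PrimeLevelFamEdge`, crux K_A `MomentsBeyondDiagonal` (stmt-Parity-20007), line «petersson_layers» v4, stub `stub_diag`:
# **the prime-sum engine `Σ_{p≤y, p∤n} (log p/(p−1))·logᵃ(y/p) = log^{a+1}y/(a+1) + O((1+κ(n))(1+log y)ᵃ)`**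

Census item G5 (second half: the prime sum) of the `stub_diag` repair census (`Lines/petersson_layers_stub_diag_g4_bricks.md`).
In the kernel form of a general profile `P` (`quadForm_profile_eq`) the von Mangoldt coupling is
`𝒫_n = Σ_{p≤M/n, p∤n}(log p/(p+1))·𝒮_{np}`; with the profile coordinate `𝒮_{np} ≈ E_{np}P″(u_{np})/log²M`
(`…DiagProfileCoord`) and `E_{np} = E_n(p+1)/(p−1)` the weight becomes `log p/(p−1)` and, expanding `P″` in powers of
`log(M/(np)) = log((M/n)/p)`, what is needed is the family of weighted Chebyshev–Mertens sums
`Σ_{p≤y, p∤n}(log p/(p−1))logᵃ(y/p)` to relative precision `O(1/log y)`: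

* `abs_sum_vonMangoldt_div_mul_log_pow_sub_le` — the `Λ`-form at every order `a ≥ 0` (tree: Mertens
  `SelbergSymmetry.abs_sum_vonMangoldt_div_sub_log_le` for `a = 0`, weighted Mertens
  `BombieriSieve.abs_sum_vonMangoldt_div_mul_pow_log_sub_le` for `a ≥ 1`):
  `|Σ_{d≤y}Λ(d)d⁻¹logᵃ(y/d) − log^{a+1}y/(a+1)| ≤ 6 logᵃy`;
* `abs_primeWeight_sub_vonMangoldt_div_le` — from `Λ(d)/d` to the prime weight `log p/(p−1)`: termwise
  `|[k prime]log k/(k−1) − Λ(k)/k| ≤ 4[k prime]/(k√k) + [k not prime]Λ(k)/k`, whose sum is `≤ 12 + 1`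
  (`PowerfulPart.sum_Icc_one_div_mul_sqrt_le`, `RosserSchoenfeld`: `Σ_{k not prime}Λ(k)/k = Σ_p log p/(p(p−1)) < 1`);
* `abs_sum_primeWeight_mul_log_pow_sub_le` — **`|Σ_{p≤y}(log p/(p−1))logᵃ(y/p) − log^{a+1}y/(a+1)| ≤ 19(1+log y)ᵃ`**;
* `sum_primeWeight_dvd_mul_log_pow_le` — the excluded primes: `Σ_{p≤y, p∣n}(log p/(p−1))logᵃ(y/p) ≤ κ(n)logᵃy`
  (`κ(n) = Σ_{p∣n}log p/(p−1)`, `SelbergCoord.kappa`);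
* `abs_sum_primeWeight_coprime_mul_log_pow_sub_le` — **the coprime version, error `(19 + κ(n))(1+log y)ᵃ`**.

Def-free; theorems only. Helper `--supports stmt-Parity-20007`; closes nothing; K_A, K_B and the Parity summit are
NOT proved; nothing about Landau–Siegel zeros.

## References
* E. Kowalski, P. Michel, J. VanderKam, J. reine angew. Math. 526 (2000), (23) p. 13 and Prop. 5.1 p. 18 (the prime
  sum of the Hecke coupling, evaluated by Mertens' theorem). [cite: KowalskiMichelVanderKam2000, Prop. 5.1 — derivation]
* T. M. Apostol, *Introduction to Analytic Number Theory*, Springer 1976, Thm 4.9 (`Σ_{n≤x}Λ(n)/n = log x + O(1)`).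
  [cite: Apostol1976, Thm 4.9]
-/

noncomputable section

open scoped Real
open Finset ArithmeticFunction

namespace Summit.Parity.GeneralizedHardyLittlewood.Theorems.MomentsBeyondDiagonal.DiagKernel

open Literature.NumberTheory.LFunctions Literature.NumberTheory.LFunctions.KMV2000
open SelbergCoord (kappa)
open Literature.NumberTheory.Sieve (BombieriSieve.abs_sum_vonMangoldt_div_mul_pow_log_sub_le
  SelbergSymmetry.abs_sum_vonMangoldt_div_sub_log_le PowerfulPart.sum_Icc_one_div_mul_sqrt_le)
open Literature.Barriers.Parity (Icc_one_eq_Ioc_zero)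

/-! ### The `Λ`-form at every order -/

/-- **Weighted Mertens at every order `a ≥ 0`**: `|Σ_{d≤y}Λ(d)d⁻¹logᵃ(y/d) − log^{a+1}y/(a+1)| ≤ 6·logᵃy` for
`y ≥ 1` (`a = 0`: Mertens; `a ≥ 1`: partial summation, tree). [cite: Apostol1976, Thm 4.9] -/
theorem abs_sum_vonMangoldt_div_mul_log_pow_sub_le {y : ℝ} (hy : 1 ≤ y) (a : ℕ) :
    |∑ d ∈ Icc 1 ⌊y⌋₊, (Λ d : ℝ) / (d : ℝ) * Real.log (y / d) ^ a - Real.log y ^ (a + 1) / ((a : ℝ) + 1)| ≤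
      6 * Real.log y ^ a := by
  rw [Icc_one_eq_Ioc_zero]
  rcases a with _ | j
  · have h := SelbergSymmetry.abs_sum_vonMangoldt_div_sub_log_le hy
    simpa using h
  · have h := BombieriSieve.abs_sum_vonMangoldt_div_mul_pow_log_sub_le hy j
    push_cast
    rw [show (j : ℝ) + 1 + 1 = (j : ℝ) + 2 by ring, show j + 1 + 1 = j + 2 by ring]
    exact h

/-! ### From `Λ(d)/d` to the prime weight `log p/(p−1)` -/

/-- `log k/(k(k−1)) ≤ 4/(k√k)` for `k ≥ 2` (`log k ≤ 2√k`, `k − 1 ≥ k/2`). [folklore] -/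
theorem log_div_mul_pred_le_four_div {k : ℕ} (hk : 2 ≤ k) :
    Real.log k / ((k : ℝ) * ((k : ℝ) - 1)) ≤ 4 / ((k : ℝ) * Real.sqrt k) := by
  have hk2 : (2 : ℝ) ≤ k := by exact_mod_cast hk
  have hk0 : (0 : ℝ) < k := by linarith
  have hsq : 0 < Real.sqrt k := Real.sqrt_pos.2 hk0
  have hlog : Real.log k ≤ 2 * Real.sqrt k := by
    have h := Real.log_le_rpow_div hk0.le (by norm_num : (0 : ℝ) < 1 / 2)
    rw [← Real.sqrt_eq_rpow] at h
    linarith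
  have hss : Real.sqrt k * Real.sqrt k = k := Real.mul_self_sqrt hk0.le
  rw [div_le_div_iff₀ (by nlinarith) (by positivity)]
  calc Real.log k * ((k : ℝ) * Real.sqrt k) ≤ 2 * Real.sqrt k * ((k : ℝ) * Real.sqrt k) := by gcongr
    _ = 2 * (k : ℝ) * (k : ℝ) := by rw [show 2 * Real.sqrt k * ((k : ℝ) * Real.sqrt k) =
        2 * (k : ℝ) * (Real.sqrt k * Real.sqrt k) by ring, hss]
    _ ≤ 4 * ((k : ℝ) * ((k : ℝ) - 1)) := by nlinarith

/-- **Termwise**: `|[k prime]·log k/(k−1) − Λ(k)/k| ≤ 4[k prime]/(k√k) + [k not prime]·Λ(k)/k` (`k ≥ 1`).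
[folklore] -/
theorem abs_primeWeight_sub_vonMangoldt_div_le {k : ℕ} (hk : k ≠ 0) :
    |(if k.Prime then Real.log k / ((k : ℝ) - 1) else 0) - (Λ k : ℝ) / (k : ℝ)| ≤
      (if k.Prime then 4 / ((k : ℝ) * Real.sqrt k) else 0) + (if k.Prime then 0 else (Λ k : ℝ)) / (k : ℝ) := by
  have hk0 : (0 : ℝ) < k := by exact_mod_cast Nat.pos_of_ne_zero hk
  by_cases hp : k.Prime
  · rw [if_pos hp, if_pos hp, if_pos hp, zero_div, add_zero, vonMangoldt_apply_prime hp]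
    have hk2 : (2 : ℝ) ≤ k := by exact_mod_cast hp.two_le
    have hlog : 0 ≤ Real.log k := Real.log_nonneg (by linarith)
    have hk1 : (k : ℝ) - 1 ≠ 0 := by linarith
    have e : Real.log k / ((k : ℝ) - 1) - Real.log k / k = Real.log k / ((k : ℝ) * ((k : ℝ) - 1)) := by
      field_simp
      ring
    rw [e, abs_of_nonneg (by apply div_nonneg hlog; nlinarith)]
    exact log_div_mul_pred_le_four_div hp.two_le
  · rw [if_neg hp, if_neg hp, if_neg hp, zero_sub, abs_neg, zero_add,
      abs_of_nonneg (div_nonneg vonMangoldt_nonneg hk0.le)]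

/-- The comparison summed: `|Σ_{k≤y}([k prime]log k/(k−1) − Λ(k)/k)·logᵃ(y/k)| ≤ 13·logᵃy` for `y ≥ 1`
(`Σ_{k≤X}1/(k√k) ≤ 3`, `Σ_{k not prime}Λ(k)/k = Σ_p log p/(p(p−1)) < 1`). [folklore] -/
theorem abs_sum_primeWeight_sub_vonMangoldt_mul_log_pow_le {y : ℝ} (hy : 1 ≤ y) (a : ℕ) :
    |∑ k ∈ Icc 1 ⌊y⌋₊, ((if k.Prime then Real.log k / ((k : ℝ) - 1) else 0) - (Λ k : ℝ) / (k : ℝ)) * Real.log (y / k) ^ a| ≤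
      13 * Real.log y ^ a := by
  have hy0 : 0 < y := by linarith
  have hly : 0 ≤ Real.log y := Real.log_nonneg hy
  set N := ⌊y⌋₊ with hN
  have hterm : ∀ k ∈ Icc 1 N, |((if k.Prime then Real.log k / ((k : ℝ) - 1) else 0) - (Λ k : ℝ) / (k : ℝ)) * Real.log (y / k) ^ a| ≤
      ((if k.Prime then 4 / ((k : ℝ) * Real.sqrt k) else 0) + (if k.Prime then 0 else (Λ k : ℝ)) / (k : ℝ)) *
        Real.log y ^ a := by
    intro k hk
    have hk' := Finset.mem_Icc.1 hk
    have hk0 : k ≠ 0 := by omega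
    have hk1 : (1 : ℝ) ≤ k := by exact_mod_cast hk'.1
    have hkr : (0 : ℝ) < k := by linarith
    have hky : (k : ℝ) ≤ y := (Nat.le_floor_iff hy0.le).1 hk'.2
    have hl0 : 0 ≤ Real.log (y / k) := Real.log_nonneg ((one_le_div hkr).2 hky)
    have hl1 : Real.log (y / k) ≤ Real.log y := Real.log_le_log (div_pos hy0 hkr) (div_le_self hy0.le hk1)
    rw [abs_mul, abs_of_nonneg (pow_nonneg hl0 a)]
    refine mul_le_mul (abs_primeWeight_sub_vonMangoldt_div_le hk0) (pow_le_pow_left₀ hl0 hl1 a)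
      (pow_nonneg hl0 a) ?_
    have : 0 ≤ (if k.Prime then 0 else (Λ k : ℝ)) / (k : ℝ) := by
      split_ifs
      · simp
      · exact div_nonneg vonMangoldt_nonneg hkr.le
    positivity
  have h1 : ∑ k ∈ Icc 1 N, (if k.Prime then 4 / ((k : ℝ) * Real.sqrt k) else 0) ≤ 12 := by
    calc ∑ k ∈ Icc 1 N, (if k.Prime then 4 / ((k : ℝ) * Real.sqrt k) else 0)
        ≤ ∑ k ∈ Icc 1 N, 4 * (1 / ((k : ℝ) * Real.sqrt k)) := by
          refine Finset.sum_le_sum fun k hk ↦ ?_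
          have : 0 ≤ 4 * (1 / ((k : ℝ) * Real.sqrt k)) := by positivity
          split_ifs
          · rw [mul_one_div]
          · exact this
      _ = 4 * ∑ k ∈ Icc 1 N, 1 / ((k : ℝ) * Real.sqrt k) := by rw [Finset.mul_sum]
      _ ≤ 4 * 3 := by gcongr; exact PowerfulPart.sum_Icc_one_div_mul_sqrt_le N
      _ = 12 := by norm_num
  have h2 : ∑ k ∈ Icc 1 N, (if k.Prime then 0 else (Λ k : ℝ)) / (k : ℝ) ≤ 1 := by
    have hsub : Icc 1 N ⊆ Icc 0 N := Finset.Icc_subset_Icc_left (by norm_num)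
    calc ∑ k ∈ Icc 1 N, (if k.Prime then 0 else (Λ k : ℝ)) / (k : ℝ)
        ≤ ∑ k ∈ Icc 0 N, (if k.Prime then 0 else (Λ k : ℝ)) / (k : ℝ) := by
          refine Finset.sum_le_sum_of_subset_of_nonneg hsub fun k _ _ ↦ ?_
          split_ifs
          · simp
          · exact div_nonneg vonMangoldt_nonneg (Nat.cast_nonneg k)
      _ ≤ ∑' n : ℕ, (if n.Prime then 0 else (Λ n : ℝ)) / (n : ℝ) :=
          AlpogeFurman2026.Cheb.sum_Icc_vonMangoldt_nonPrime_div_le N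
      _ = ∑' p : Nat.Primes, Real.log (p : ℝ) / ((p : ℝ) * ((p : ℝ) - 1)) :=
          RosserSchoenfeld.tsum_vonMangoldt_nonPrime_div
      _ ≤ 1 := RosserSchoenfeld.tsum_primes_log_div_mul_pred_lt_one.le
  calc |∑ k ∈ Icc 1 N, ((if k.Prime then Real.log k / ((k : ℝ) - 1) else 0) - (Λ k : ℝ) / (k : ℝ)) * Real.log (y / k) ^ a|
      ≤ ∑ k ∈ Icc 1 N, |((if k.Prime then Real.log k / ((k : ℝ) - 1) else 0) - (Λ k : ℝ) / (k : ℝ)) * Real.log (y / k) ^ a| :=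
        Finset.abs_sum_le_sum_abs _ _
    _ ≤ ∑ k ∈ Icc 1 N, ((if k.Prime then 4 / ((k : ℝ) * Real.sqrt k) else 0) +
          (if k.Prime then 0 else (Λ k : ℝ)) / (k : ℝ)) * Real.log y ^ a := Finset.sum_le_sum hterm
    _ = ((∑ k ∈ Icc 1 N, (if k.Prime then 4 / ((k : ℝ) * Real.sqrt k) else 0)) +
          ∑ k ∈ Icc 1 N, (if k.Prime then 0 else (Λ k : ℝ)) / (k : ℝ)) * Real.log y ^ a := by
        rw [← Finset.sum_mul, Finset.sum_add_distrib]
    _ ≤ (12 + 1) * Real.log y ^ a := by gcongr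
    _ = 13 * Real.log y ^ a := by norm_num

/-- **The prime-sum engine**: `|Σ_{p≤y}(log p/(p−1))·logᵃ(y/p) − log^{a+1}y/(a+1)| ≤ 19·(1 + log y)ᵃ` for all
`y ≥ 1`, `a ≥ 0` (sum over `k ≤ y` with the prime indicator).
[cite: KowalskiMichelVanderKam2000, Prop. 5.1 — derivation (the prime sum of the Hecke coupling, by Mertens)] -/
theorem abs_sum_primeWeight_mul_log_pow_sub_le {y : ℝ} (hy : 1 ≤ y) (a : ℕ) :
    |∑ k ∈ Icc 1 ⌊y⌋₊, (if k.Prime then Real.log k / ((k : ℝ) - 1) else 0) * Real.log (y / k) ^ a -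
        Real.log y ^ (a + 1) / ((a : ℝ) + 1)| ≤ 19 * (1 + Real.log y) ^ a := by
  have hly : 0 ≤ Real.log y := Real.log_nonneg hy
  have h1 := abs_sum_vonMangoldt_div_mul_log_pow_sub_le hy a
  have h2 := abs_sum_primeWeight_sub_vonMangoldt_mul_log_pow_le hy a
  have hsplit : ∑ k ∈ Icc 1 ⌊y⌋₊, (if k.Prime then Real.log k / ((k : ℝ) - 1) else 0) * Real.log (y / k) ^ a -
      Real.log y ^ (a + 1) / ((a : ℝ) + 1) =
      ∑ k ∈ Icc 1 ⌊y⌋₊, ((if k.Prime then Real.log k / ((k : ℝ) - 1) else 0) - (Λ k : ℝ) / (k : ℝ)) * Real.log (y / k) ^ a +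
        (∑ d ∈ Icc 1 ⌊y⌋₊, (Λ d : ℝ) / (d : ℝ) * Real.log (y / d) ^ a - Real.log y ^ (a + 1) / ((a : ℝ) + 1)) := by
    rw [← add_sub_assoc, ← Finset.sum_add_distrib]
    congr 1
    exact Finset.sum_congr rfl fun k _ ↦ by ring
  rw [hsplit]
  have hpow : Real.log y ^ a ≤ (1 + Real.log y) ^ a := pow_le_pow_left₀ hly (by linarith) a
  calc |∑ k ∈ Icc 1 ⌊y⌋₊, ((if k.Prime then Real.log k / ((k : ℝ) - 1) else 0) - (Λ k : ℝ) / (k : ℝ)) * Real.log (y / k) ^ a +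
          (∑ d ∈ Icc 1 ⌊y⌋₊, (Λ d : ℝ) / (d : ℝ) * Real.log (y / d) ^ a - Real.log y ^ (a + 1) / ((a : ℝ) + 1))|
      ≤ 13 * Real.log y ^ a + 6 * Real.log y ^ a := (abs_add_le _ _).trans (add_le_add h2 h1)
    _ ≤ 19 * (1 + Real.log y) ^ a := by nlinarith

/-! ### Excluding the primes dividing `n` -/

/-- **The excluded primes**: `Σ_{p≤y, p∣n}(log p/(p−1))·logᵃ(y/p) ≤ κ(n)·logᵃy` for `n ≥ 1`, `y ≥ 1`
(`κ(n) = Σ_{p∣n}log p/(p−1)`). [folklore] -/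
theorem sum_primeWeight_dvd_mul_log_pow_le {n : ℕ} (hn : n ≠ 0) {y : ℝ} (hy : 1 ≤ y) (a : ℕ) :
    0 ≤ ∑ k ∈ Icc 1 ⌊y⌋₊, (if k.Prime ∧ k ∣ n then Real.log k / ((k : ℝ) - 1) else 0) * Real.log (y / k) ^ a ∧
    ∑ k ∈ Icc 1 ⌊y⌋₊, (if k.Prime ∧ k ∣ n then Real.log k / ((k : ℝ) - 1) else 0) * Real.log (y / k) ^ a ≤
      kappa n * Real.log y ^ a := by
  have hy0 : 0 < y := by linarith
  have hly : 0 ≤ Real.log y := Real.log_nonneg hy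
  set N := ⌊y⌋₊ with hN
  have hw : ∀ k : ℕ, 0 ≤ (if k.Prime ∧ k ∣ n then Real.log k / ((k : ℝ) - 1) else 0) := by
    intro k
    split_ifs with h
    · have hk2 : (2 : ℝ) ≤ k := by exact_mod_cast h.1.two_le
      exact div_nonneg (Real.log_nonneg (by linarith)) (by linarith)
    · exact le_rfl
  have hlk : ∀ k ∈ Icc 1 N, 0 ≤ Real.log (y / k) ∧ Real.log (y / k) ≤ Real.log y := by
    intro k hk
    have hk' := Finset.mem_Icc.1 hk
    have hk1 : (1 : ℝ) ≤ k := by exact_mod_cast hk'.1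
    have hkr : (0 : ℝ) < k := by linarith
    have hky : (k : ℝ) ≤ y := (Nat.le_floor_iff hy0.le).1 hk'.2
    exact ⟨Real.log_nonneg ((one_le_div hkr).2 hky),
      Real.log_le_log (div_pos hy0 hkr) (div_le_self hy0.le hk1)⟩
  refine ⟨Finset.sum_nonneg fun k hk ↦ mul_nonneg (hw k) (pow_nonneg (hlk k hk).1 a), ?_⟩
  calc ∑ k ∈ Icc 1 N, (if k.Prime ∧ k ∣ n then Real.log k / ((k : ℝ) - 1) else 0) * Real.log (y / k) ^ a
      ≤ ∑ k ∈ Icc 1 N, (if k.Prime ∧ k ∣ n then Real.log k / ((k : ℝ) - 1) else 0) * Real.log y ^ a :=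
        Finset.sum_le_sum fun k hk ↦ mul_le_mul_of_nonneg_left
          (pow_le_pow_left₀ (hlk k hk).1 (hlk k hk).2 a) (hw k)
    _ = (∑ k ∈ (Icc 1 N).filter (fun k ↦ k.Prime ∧ k ∣ n), Real.log k / ((k : ℝ) - 1)) * Real.log y ^ a := by
        rw [Finset.sum_filter, Finset.sum_mul]
    _ ≤ kappa n * Real.log y ^ a := by
        refine mul_le_mul_of_nonneg_right ?_ (pow_nonneg hly a)
        unfold kappa
        refine Finset.sum_le_sum_of_subset_of_nonneg (fun k hk ↦ ?_) (fun p hp _ ↦ ?_)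
        · have h := (Finset.mem_filter.1 hk).2
          exact Nat.mem_primeFactors.2 ⟨h.1, h.2, hn⟩
        · have hp2 : (2 : ℝ) ≤ p := by exact_mod_cast (Nat.prime_of_mem_primeFactors hp).two_le
          exact div_nonneg (Real.log_nonneg (by linarith)) (by linarith)

/-- **The coprime prime-sum engine**: for `n ≥ 1`, `y ≥ 1`, `a ≥ 0`,
`|Σ_{p≤y, p∤n}(log p/(p−1))·logᵃ(y/p) − log^{a+1}y/(a+1)| ≤ (19 + κ(n))·(1 + log y)ᵃ`.
[cite: KowalskiMichelVanderKam2000, Prop. 5.1 — derivation (the prime sum of the Hecke coupling, coprime to `n`)] -/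
theorem abs_sum_primeWeight_coprime_mul_log_pow_sub_le {n : ℕ} (hn : n ≠ 0) {y : ℝ} (hy : 1 ≤ y) (a : ℕ) :
    |∑ k ∈ Icc 1 ⌊y⌋₊, (if k.Prime ∧ ¬ k ∣ n then Real.log k / ((k : ℝ) - 1) else 0) * Real.log (y / k) ^ a -
        Real.log y ^ (a + 1) / ((a : ℝ) + 1)| ≤ (19 + kappa n) * (1 + Real.log y) ^ a := by
  have hly : 0 ≤ Real.log y := Real.log_nonneg hy
  have h1 := abs_sum_primeWeight_mul_log_pow_sub_le hy a
  obtain ⟨h20, h2⟩ := sum_primeWeight_dvd_mul_log_pow_le hn hy a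
  have hsplit : ∑ k ∈ Icc 1 ⌊y⌋₊, (if k.Prime ∧ ¬ k ∣ n then Real.log k / ((k : ℝ) - 1) else 0) * Real.log (y / k) ^ a =
      ∑ k ∈ Icc 1 ⌊y⌋₊, (if k.Prime then Real.log k / ((k : ℝ) - 1) else 0) * Real.log (y / k) ^ a -
        ∑ k ∈ Icc 1 ⌊y⌋₊, (if k.Prime ∧ k ∣ n then Real.log k / ((k : ℝ) - 1) else 0) * Real.log (y / k) ^ a := by
    rw [← Finset.sum_sub_distrib]
    refine Finset.sum_congr rfl fun k _ ↦ ?_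
    by_cases hp : k.Prime
    · by_cases hd : k ∣ n
      · rw [if_neg (fun h ↦ h.2 hd), if_pos hp, if_pos ⟨hp, hd⟩]; ring
      · rw [if_pos ⟨hp, hd⟩, if_pos hp, if_neg (fun h ↦ hd h.2)]; ring
    · rw [if_neg (fun h ↦ hp h.1), if_neg hp, if_neg (fun h ↦ hp h.1)]; ring
  rw [hsplit]
  have hpow : Real.log y ^ a ≤ (1 + Real.log y) ^ a := pow_le_pow_left₀ hly (by linarith) a
  have hk0 : 0 ≤ kappa n := by
    unfold kappa
    exact Finset.sum_nonneg fun p hp ↦ by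
      have hp2 : (2 : ℝ) ≤ p := by exact_mod_cast (Nat.prime_of_mem_primeFactors hp).two_le
      exact div_nonneg (Real.log_nonneg (by linarith)) (by linarith)
  calc |∑ k ∈ Icc 1 ⌊y⌋₊, (if k.Prime then Real.log k / ((k : ℝ) - 1) else 0) * Real.log (y / k) ^ a -
          ∑ k ∈ Icc 1 ⌊y⌋₊, (if k.Prime ∧ k ∣ n then Real.log k / ((k : ℝ) - 1) else 0) * Real.log (y / k) ^ a -
          Real.log y ^ (a + 1) / ((a : ℝ) + 1)|
      = |(∑ k ∈ Icc 1 ⌊y⌋₊, (if k.Prime then Real.log k / ((k : ℝ) - 1) else 0) * Real.log (y / k) ^ a -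
          Real.log y ^ (a + 1) / ((a : ℝ) + 1)) -
          ∑ k ∈ Icc 1 ⌊y⌋₊, (if k.Prime ∧ k ∣ n then Real.log k / ((k : ℝ) - 1) else 0) * Real.log (y / k) ^ a| := by
        ring_nf
    _ ≤ 19 * (1 + Real.log y) ^ a + kappa n * Real.log y ^ a := by
        refine (abs_sub _ _).trans (add_le_add h1 ?_)
        rwa [abs_of_nonneg h20]
    _ ≤ (19 + kappa n) * (1 + Real.log y) ^ a := by nlinarith

end Summit.Parity.GeneralizedHardyLittlewood.Theorems.MomentsBeyondDiagonal.DiagKernel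

end
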